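import Summits.BirchSwinnertonDyer.Rank1Residual.P2.CongruentNumberThetaThreePrimesD
import HarnessLib
import HarnessLib.Audit.Tags

/-!
# Cell «bsd-monsky» (prover-B): the `k = 3` type `(1, 5, 7)` through the uniform Θ-criterion — THEOREM B₃(157) and the
# family theorems: for primes `p₁ ≡ 1`, `p₂ ≡ 5`, `p₃ ≡ 7 (mod 8)` with AT LEAST TWO of `(p₂/p₁), (p₃/p₁), (p₃/p₂)` equal to
# `−1`: `ord_{s=1} L(E_{2p₁p₂p₃}, s) = 1` (relative to {`tyz_cmPointGaloisData`, TYZ Thm. 1.1}), rank `1`, `Ш[2^∞] = 0`,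
# `BSD(E, 2)` (+ GZK, Monsky's even matrix theorem) (kernel theorem; nothing asserted, nothing booked)

HONEST FRAMING (cell `bsd-monsky`, run/shared/lean/pub/bsd-monsky/; README §1/§3): the cell's CLAIMED theorem is Monsky's
1990 conjecture on the `k = 2` family `𝒮⁻`; «ℓ ≥ 3 rungs (C-P2-2 for k ≥ 3) are NOT claimed — record what the same argument
gives there, no more». THIS FILE COMPLETES THAT RECORD for the type `(1, 5, 7)` (companion `P2/CongruentNumberThetaThreePrimesD.lean`:
`θ`-control, the Θ-certificate `Θ(n) = g(n) + 𝓛(p₁)g(2p₂p₃)`, and the configuration facts `g(n) ≡ s₀s₁ + s₀s₂ + s₁s₂`,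
`g(2p₂p₃) ≡ s₂`, `g(p₁)` even, `𝓛(p₁)` even [TYZ Thm. 1.1], `s(n) = 1` iff `s₀ ∨ s₁`, `Σ₂′ ≡ s₀ + s₁ + s₀s₁ + s₀s₂ + s₁s₂`) by ONE
application of the UNIFORM Θ-criterion `ThetaDescent.odd_scriptL_of_thetaCert` (`P2/CongruentNumberThetaCriterion.lean`):
* §1 THEOREM B₃(157) `odd_scriptL_two_mul_157`: `D.Printed`, `D.CMPointGaloisPrinted`, rank `≤ 1` once `𝓛 ≠ 0`, TYZ Thm. 1.1
  (`h11`), and `s₀s₁ + s₀s₂ + s₁s₂ = 1` ⟹ `𝓛(n)` odd; `𝓛(n) ≠ 0` WITHOUT rank input; clause (a) from {display, `h11`};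
* §2 the rank-one datum (`x = 2⁴L²`, `ord₂ x = 4`) and `BSD(E_n, 2)` through the landed even door (`s(n) = 1` follows from the
  bits: two of three set ⟹ `s₀ ∨ s₁`);
* §3 the bits from the Jacobi symbols («at least two of the three symbols are `−1`») and THE FAMILY THEOREMS; TYZ's `Σ₂′(n)` is
  EVEN on the sub-family `(p₃/p₂) = −1`, `(p₂/p₁) ≠ (p₃/p₁)` (census types `[1,5,7]/[0,1,1]` (`2870 = 2·41·5·7`), `[1,0,1]`
  (`7910 = 2·113·5·7`)) — there Theorem 1.2 of [TianYuanZhang2017] and the U⁺ door are SILENT and this file's theorem is Monsky's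
  C-P2-2 at `k = 3` on an explicit infinite family; on `(p₂/p₁) = (p₃/p₁) = −1` it re-derives TYZ (loud).
CONDITIONAL on the named facts said; nothing asserted; no count moves; no class booked (smallest members `2870`, `7910`; none
below the book230 bound `176`). NOT refereed; not part of PROOF-B v1.3 or of the paper; EVIDENCE for the planner (D-0059).

References: [TianYuanZhang2017] Thm. 1.1, Thm. 1.2, §1 (1.1), §3; [HeathBrown1994SelmerCongruentII] Appendix (Monsky) p. 41
L20–L36; [LiMa2008] Thm. 0.4; [IrelandRosen1990] Ch. 5 §2 Thm. 1; [Miller2011LMS] Def. 1.1; HOME/proof/PROOF-B-K3-SCOPE.md §4;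
HOME/proof/PROOF-B-THETA-CRITERION.md.
-/

noncomputable section

open scoped Classical

open Matrix Finset WeierstrassCurve Literature.NumberTheory.EllipticCurves
  Literature.NumberTheory.EllipticCurves.Rank1Residual
  Literature.NumberTheory.EllipticCurves.Rank1Residual.Typed
  Literature.NumberTheory.EllipticCurves.HeathBrown1994
  Literature.NumberTheory.EllipticCurves.Tian2014
  Literature.NumberTheory.EllipticCurves.TianYuanZhang2017
  Literature.NumberTheory.EllipticCurves.TianYuanZhang2017.W2
  Literature.NumberTheory.QuadraticFields.RedeiReichardt

set_option autoImplicit false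

namespace Summit.BirchSwinnertonDyer.Rank1Residual.P2

namespace ThetaDescent

variable {p₁ p₂ p₃ : ℕ}

/-! ## §1 THEOREM B₃(157) through the uniform Θ-criterion -/

/-- `n = 2p₁p₂p₃` is square-free for the type `(1, 5, 7)`. [cite: HardyWright2008, §1.3 Thm. 2] -/
theorem squarefree_two_mul_157 (hp₁ : p₁.Prime) (hp₂ : p₂.Prime) (hp₃ : p₃.Prime) (h₁ : p₁ % 8 = 1) (h₂ : p₂ % 8 = 5)
    (h₃ : p₃ % 8 = 7) : Squarefree (2 * (p₁ * p₂ * p₃)) := by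
  obtain ⟨ht, -, hinj⟩ := triple_157 hp₁ hp₂ hp₃ h₁ h₂ h₃
  have hodd : ∀ i, Odd ((![p₁, p₂, p₃] : Fin 3 → ℕ) i) := fun i => by
    fin_cases i <;> exact Nat.odd_iff.mpr (by simp; omega)
  have h := squarefree_two_mul_prod_of_injective _ ht hodd hinj
  rwa [Fin.prod_univ_three] at h

/-- `2p₁p₂p₃ ≡ 6 (mod 8)` for the type `(1, 5, 7)`. [cite: TianYuanZhang2017, §3 (p0010 L3–L5)] -/
theorem two_mul_157_mod_eight (h₁ : p₁ % 8 = 1) (h₂ : p₂ % 8 = 5) (h₃ : p₃ % 8 = 7) : (2 * (p₁ * p₂ * p₃)) % 8 = 6 := by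
  have h12m : (p₁ * p₂) % 8 = 5 := by rw [Nat.mul_mod, h₁, h₂]
  have hm3 : (p₁ * p₂ * p₃) % 8 = 3 := by rw [Nat.mul_mod, h12m, h₃]
  omega

/-- **THEOREM B₃ for the type `(1, 5, 7)`, by the UNIFORM Θ-criterion.** For primes `p₁ ≡ 1`, `p₂ ≡ 5`, `p₃ ≡ 7 (mod 8)`, TYZ data
`D` for `n = 2p₁p₂p₃` with `D.Printed` and `D.CMPointGaloisPrinted`, TYZ Thm. 1.1 (`h11`), and rank `E_n(ℚ) ≤ 1` once `𝓛(n) ≠ 0`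
(`hr`): if at least two of the bits `s₀ = [(p₂/p₁) = −1]`, `s₁ = [(p₃/p₁) = −1]`, `s₂ = [(p₃/p₂) = −1]` are set (`s₀s₁ + s₀s₂ + s₁s₂
= 1`, i.e. `g(n)` odd), then `𝓛(n)` is ODD. (`Θ(n) = g(n) + 𝓛(p₁)g(2p₂p₃) ≡ g(n)` since `𝓛(p₁)` is even.)
[cite: TianYuanZhang2017, Thm. 1.1, Thm. 3.5 (p0011 L94–L112), Thm. 3.6 (2) (J741), §3.1 (p0011 L67–L73), proof of Lemma 3.21 (J759)]
[cite: LiMa2008, Thm. 0.4] -/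
theorem odd_scriptL_two_mul_157 (h11 : thm11_parity_of_scriptL) (hp₁ : p₁.Prime) (hp₂ : p₂.Prime) (hp₃ : p₃.Prime)
    (h₁ : p₁ % 8 = 1) (h₂ : p₂ % 8 = 5) (h₃ : p₃ % 8 = 7) (D : GenusPointData (2 * (p₁ * p₂ * p₃)))
    (hD : D.Printed) (hG : D.CMPointGaloisPrinted)
    (hr :
      letI := isElliptic_congruentNumberCurve (squarefree_two_mul_157 hp₁ hp₂ hp₃ h₁ h₂ h₃).ne_zero
      D.scriptL (2 * (p₁ * p₂ * p₃)) ≠ 0 → (congruentNumberCurve (2 * (p₁ * p₂ * p₃))).mordellWeilRank ≤ 1)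
    (hbits : kroneckerBit p₂ p₁ * kroneckerBit p₃ p₁ + kroneckerBit p₂ p₁ * kroneckerBit p₃ p₂ +
      kroneckerBit p₃ p₁ * kroneckerBit p₃ p₂ = 1) :
    Odd (D.scriptL (2 * (p₁ * p₂ * p₃))) := by
  have hsq := squarefree_two_mul_157 hp₁ hp₂ hp₃ h₁ h₂ h₃
  have hn6 := two_mul_157_mod_eight h₁ h₂ h₃
  have hn0 : 2 * (p₁ * p₂ * p₃) ≠ 0 := hsq.ne_zero
  -- `𝓛(p₁)` is even (TYZ Thm. 1.1 + `g(p₁)` even)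
  have h1n : p₁ ∈ (2 * (p₁ * p₂ * p₃)).divisors := Nat.mem_divisors.mpr ⟨Dvd.intro (2 * (p₂ * p₃)) (by ring), hn0⟩
  have hL1 : IsScriptL p₁ (D.scriptL p₁) := hD.1 _ h1n hp₁.one_lt
  have hlam : (D.scriptL p₁ : ZMod 2) = 0 :=
    ZMod.intCast_eq_zero_iff_even.mpr (even_of_isScriptL_p₁_157 h11 hp₁ hp₂ hp₃ h₁ h₂ h₃ hL1)
  -- `g(n)` is odd
  have hg : (gK (2 * (p₁ * p₂ * p₃)) : ZMod 2) = 1 :=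
    ZMod.natCast_eq_one_iff_odd.mpr ((odd_gK_two_mul_157_iff_bits hp₁ hp₂ hp₃ h₁ h₂ h₃).mpr hbits)
  have hne : 2 * (p₁ * p₂ * p₃) ≠ 2 * (p₂ * p₃) := by
    intro h
    have h' : (p₂ * p₃) * p₁ = (p₂ * p₃) * 1 := by
      rw [mul_one, show (p₂ * p₃) * p₁ = p₁ * p₂ * p₃ by ring]; omega
    have h'' := Nat.eq_of_mul_eq_mul_left (Nat.mul_pos hp₂.pos hp₃.pos) h'
    have := hp₁.one_lt
    omega
  refine odd_scriptL_of_thetaCert hsq hn6 D hD hG hr (thetaControlled_two_mul_157 hp₁ hp₂ hp₃ h₁ h₂ h₃) _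
    (thetaCert_two_mul_157 hp₁ hp₂ hp₃ h₁ h₂ h₃ D) ?_
  simp only [if_neg hne, hlam, hg, zero_mul, add_zero]

/-- **`𝓛(n) ≠ 0` for the type `(1, 5, 7)` with `g(n)` odd — NO rank input.** [cite: TianYuanZhang2017, Thm. 3.5 (p0011 L94–L95), Lemma 3.18] -/
theorem scriptL_ne_zero_two_mul_157 (h11 : thm11_parity_of_scriptL) (hp₁ : p₁.Prime) (hp₂ : p₂.Prime) (hp₃ : p₃.Prime)
    (h₁ : p₁ % 8 = 1) (h₂ : p₂ % 8 = 5) (h₃ : p₃ % 8 = 7) (D : GenusPointData (2 * (p₁ * p₂ * p₃)))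
    (hD : D.Printed) (hG : D.CMPointGaloisPrinted)
    (hbits : kroneckerBit p₂ p₁ * kroneckerBit p₃ p₁ + kroneckerBit p₂ p₁ * kroneckerBit p₃ p₂ +
      kroneckerBit p₃ p₁ * kroneckerBit p₃ p₂ = 1) :
    D.scriptL (2 * (p₁ * p₂ * p₃)) ≠ 0 := by
  intro h0
  have h := odd_scriptL_two_mul_157 h11 hp₁ hp₂ hp₃ h₁ h₂ h₃ D hD hG (fun h => absurd h0 h) hbits
  rw [h0] at h
  exact (Int.not_odd_iff_even.mpr Even.zero) h

/-- **Clause (a) for the type `(1, 5, 7)` with `g(n)` odd, from the display and TYZ Thm. 1.1**: `ord_{s=1} L(E_n, s) = 1`.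
No GZK, no Selmer input, no genus-sum hypothesis. CONDITIONAL; nothing asserted. [cite: TianYuanZhang2017, §1 (p0002 L46–L75), Thm. 1.1, §3] -/
theorem analyticRank_eq_one_two_mul_157_of_cmPointGaloisData (hCM : tyz_cmPointGaloisData)
    (h11 : thm11_parity_of_scriptL) (hp₁ : p₁.Prime) (hp₂ : p₂.Prime) (hp₃ : p₃.Prime) (h₁ : p₁ % 8 = 1)
    (h₂ : p₂ % 8 = 5) (h₃ : p₃ % 8 = 7)
    (hbits : kroneckerBit p₂ p₁ * kroneckerBit p₃ p₁ + kroneckerBit p₂ p₁ * kroneckerBit p₃ p₂ +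
      kroneckerBit p₃ p₁ * kroneckerBit p₃ p₂ = 1) :
    (congruentNumberCurve (2 * (p₁ * p₂ * p₃))).analyticRank = 1 := by
  have hsq := squarefree_two_mul_157 hp₁ hp₂ hp₃ h₁ h₂ h₃
  have hn6 := two_mul_157_mod_eight h₁ h₂ h₃
  obtain ⟨D, hD, hG⟩ := hCM _ hsq (Or.inr (Or.inl hn6))
  have hL : IsScriptL _ (D.scriptL (2 * (p₁ * p₂ * p₃))) := hD.1 _ (Nat.mem_divisors_self _ hsq.ne_zero) (by omega)
  exact analyticRank_congruentNumberCurve_eq_one_of_isScriptL hsq (Or.inr (Or.inl hn6)) hL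
    (scriptL_ne_zero_two_mul_157 h11 hp₁ hp₂ hp₃ h₁ h₂ h₃ D hD hG hbits)

/-- **THEOREM B₃(157), output shape**: an ODD integer `L` with `L² = 𝓛(n)²`, relative to {`tyz_cmPointGaloisData`, TYZ Thm. 1.1, GZK}.
CONDITIONAL; nothing asserted. [cite: TianYuanZhang2017, Thm. 3.5 and §3] -/
theorem exists_odd_isScriptL_two_mul_157 (hCM : tyz_cmPointGaloisData) (h11 : thm11_parity_of_scriptL)
    (hGZK : rank_eq_analyticRank_of_analyticRank_le_one) (hp₁ : p₁.Prime) (hp₂ : p₂.Prime) (hp₃ : p₃.Prime)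
    (h₁ : p₁ % 8 = 1) (h₂ : p₂ % 8 = 5) (h₃ : p₃ % 8 = 7)
    (hbits : kroneckerBit p₂ p₁ * kroneckerBit p₃ p₁ + kroneckerBit p₂ p₁ * kroneckerBit p₃ p₂ +
      kroneckerBit p₃ p₁ * kroneckerBit p₃ p₂ = 1) :
    ∃ L : ℤ, Odd L ∧ IsScriptL (2 * (p₁ * p₂ * p₃)) L := by
  have hsq := squarefree_two_mul_157 hp₁ hp₂ hp₃ h₁ h₂ h₃
  haveI := isElliptic_congruentNumberCurve hsq.ne_zero
  have hn6 := two_mul_157_mod_eight h₁ h₂ h₃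
  obtain ⟨D, hD, hG⟩ := hCM _ hsq (Or.inr (Or.inl hn6))
  have hL : IsScriptL _ (D.scriptL (2 * (p₁ * p₂ * p₃))) := hD.1 _ (Nat.mem_divisors_self _ hsq.ne_zero) (by omega)
  refine ⟨_, odd_scriptL_two_mul_157 h11 hp₁ hp₂ hp₃ h₁ h₂ h₃ D hD hG (fun hL0 => ?_) hbits, hL⟩
  have har := S4 hsq (Or.inr (Or.inl hn6)) hL hL0
  rw [(hGZK (congruentNumberCurve _) har).1]; exact har

/-! ## §2 The rank-one datum and `BSD(E_n, 2)` through the landed even door -/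

/-- **The rank-one datum of the type `(1, 5, 7)` with `g(n)` odd**: `ord_{s=1} L(E_n, s) = 1` and `L′(E_n, 1) = x·Ω·Reg` with
`x = 2⁴·L²`, `L` odd, `ord₂ x = 4`. Relative to {`tyz_cmPointGaloisData`, TYZ Thm. 1.1, GZK}; nothing asserted.
[cite: TianYuanZhang2017, §1 ((1.1), p0002 L63–L75)] -/
theorem rankOneDatum_two_mul_157 (hCM : tyz_cmPointGaloisData) (h11 : thm11_parity_of_scriptL)
    (hGZK : rank_eq_analyticRank_of_analyticRank_le_one) (hp₁ : p₁.Prime) (hp₂ : p₂.Prime) (hp₃ : p₃.Prime)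
    (h₁ : p₁ % 8 = 1) (h₂ : p₂ % 8 = 5) (h₃ : p₃ % 8 = 7)
    (hbits : kroneckerBit p₂ p₁ * kroneckerBit p₃ p₁ + kroneckerBit p₂ p₁ * kroneckerBit p₃ p₂ +
      kroneckerBit p₃ p₁ * kroneckerBit p₃ p₂ = 1) :
    (congruentNumberCurve (2 * (p₁ * p₂ * p₃))).analyticRank = 1 ∧
    ∃ x : ℚ, x ≠ 0 ∧ padicValRat 2 x = 4 ∧
      deriv (congruentNumberCurve (2 * (p₁ * p₂ * p₃))).entireLFunction 1 =
        (x : ℂ) * ((congruentNumberCurve (2 * (p₁ * p₂ * p₃))).realPeriodRat : ℂ) *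
          ((congruentNumberCurve (2 * (p₁ * p₂ * p₃))).regulator : ℂ) := by
  have hsq := squarefree_two_mul_157 hp₁ hp₂ hp₃ h₁ h₂ h₃
  haveI := isElliptic_congruentNumberCurve hsq.ne_zero
  have hn6 := two_mul_157_mod_eight h₁ h₂ h₃
  obtain ⟨L, hLodd, hL⟩ := exists_odd_isScriptL_two_mul_157 hCM h11 hGZK hp₁ hp₂ hp₃ h₁ h₂ h₃ hbits
  have hL0' : L ≠ 0 := fun h => by simp [h] at hLodd
  have hL0 : (L : ℚ) ≠ 0 := by exact_mod_cast hL0'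
  have hr1 := analyticRank_congruentNumberCurve_eq_one_of_isScriptL hsq (Or.inr (Or.inl hn6)) hL hL0'
  obtain ⟨ht, -, hinj⟩ := triple_157 hp₁ hp₂ hp₃ h₁ h₂ h₃
  have hodd : ∀ i, Odd ((![p₁, p₂, p₃] : Fin 3 → ℕ) i) := fun i => by
    fin_cases i <;> exact Nat.odd_iff.mpr (by simp; omega)
  have he : twoExponent (2 * (p₁ * p₂ * p₃)) = 4 := by
    have h := twoExponent_two_mul_prod_eq _ ht hodd hinj
    rw [Fin.prod_univ_three] at h
    norm_num at h
    exact h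
  refine ⟨hr1, (2 : ℚ) ^ twoExponent (2 * (p₁ * p₂ * p₃)) * (L : ℚ) ^ 2,
    mul_ne_zero (zpow_ne_zero _ two_ne_zero) (pow_ne_zero _ hL0), ?_, ?_⟩
  · rw [padicValRat_two_zpow_mul_sq hLodd, he]
  · rw [← (leadingLCoeff_eq_deriv_of_analyticRank_eq_one hr1).1,
      leadingLCoeff_congruentNumberCurve_eq_of_isScriptL (Nat.pos_of_ne_zero hsq.ne_zero) hr1 hL]
    push_cast
    ring

/-- **`ord_{s=1} L = 1`, rank `1`, `Ш[2^∞] = 0` and `BSD(E_n, 2)` for the type `(1, 5, 7)` with `g(n)` odd**, relative to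
{`tyz_cmPointGaloisData`, TYZ Thm. 1.1, GZK, `hMe` = Monsky's even `2`-descent matrix theorem}: the rank-one datum through the landed
even door; the Selmer input `s(n) = 1` follows from the bits (two of three set ⟹ `s₀ = 1` or `s₁ = 1`, `monskySelmerRankEven_157`).
CONDITIONAL; nothing asserted; closes no class by itself.
[cite: TianYuanZhang2017, §1 (1.1), Thm. 3.5] [cite: HeathBrown1994SelmerCongruentII, Appendix (Monsky), typescript p. 41 L20–L36]
[cite: Miller2011LMS, Def. 1.1 (arXiv:1010.2431 p. 3)] -/
theorem rankOne_sha_bsdp_two_two_mul_157 (hCM : tyz_cmPointGaloisData) (h11 : thm11_parity_of_scriptL)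
    (hGZK : rank_eq_analyticRank_of_analyticRank_le_one) (hMe : monsky_card_selmerGroup_two_even)
    (hp₁ : p₁.Prime) (hp₂ : p₂.Prime) (hp₃ : p₃.Prime) (h₁ : p₁ % 8 = 1) (h₂ : p₂ % 8 = 5) (h₃ : p₃ % 8 = 7)
    (hbits : kroneckerBit p₂ p₁ * kroneckerBit p₃ p₁ + kroneckerBit p₂ p₁ * kroneckerBit p₃ p₂ +
      kroneckerBit p₃ p₁ * kroneckerBit p₃ p₂ = 1) :
    (congruentNumberCurve (2 * (p₁ * p₂ * p₃))).analyticRank = 1 ∧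
      (congruentNumberCurve (2 * (p₁ * p₂ * p₃))).mordellWeilRank = 1 ∧
      AddCommGroup.primaryComponent (congruentNumberCurve (2 * (p₁ * p₂ * p₃))).sha 2 = ⊥ ∧
      BSDp (congruentNumberCurve (2 * (p₁ * p₂ * p₃))) 2 := by
  have hn6 := two_mul_157_mod_eight h₁ h₂ h₃
  have h12 : p₁ ≠ p₂ := fun h => by omega
  have h13 : p₁ ≠ p₃ := fun h => by omega
  have h23 : p₂ ≠ p₃ := fun h => by omega
  have key : ∀ a b c : ZMod 2, a * b + a * c + b * c = 1 → a + b + a * b = 1 := by decide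
  have hs := monskySelmerRankEven_157 hp₁ hp₂ hp₃ h₁ h₂ h₃ (key _ _ _ hbits)
  obtain ⟨-, x, hx0, hv, hx⟩ := rankOneDatum_two_mul_157 hCM h11 hGZK hp₁ hp₂ hp₃ h₁ h₂ h₃ hbits
  obtain ⟨hr1, hrk, hsha, hiff⟩ :=
    rankOne_sha_bsdp_two_iff_congruentNumberCurve_two_mul_pqr hGZK hMe hp₁ hp₂ hp₃ h12 h13 h23 hn6 hs hx0 hx
  exact ⟨hr1, hrk, hsha, hiff.mpr hv⟩

/-! ## §3 The bits from the Jacobi symbols; the family theorems; TYZ is silent on half of the family -/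

/-- «At least two of `(p₂/p₁), (p₃/p₁), (p₃/p₂)` are `−1`» ⟹ `s₀s₁ + s₀s₂ + s₁s₂ = 1`. [cite: IrelandRosen1990, Ch. 5 §2 Thm. 1] -/
theorem bits_157_of_jacobiSym (hp₁ : p₁.Prime) (hp₂ : p₂.Prime) (hp₃ : p₃.Prime) (h₁ : p₁ % 8 = 1) (h₂ : p₂ % 8 = 5)
    (h₃ : p₃ % 8 = 7)
    (hj : (jacobiSym (p₂ : ℤ) p₁ = -1 ∧ jacobiSym (p₃ : ℤ) p₁ = -1) ∨ (jacobiSym (p₂ : ℤ) p₁ = -1 ∧ jacobiSym (p₃ : ℤ) p₂ = -1) ∨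
      (jacobiSym (p₃ : ℤ) p₁ = -1 ∧ jacobiSym (p₃ : ℤ) p₂ = -1)) :
    kroneckerBit p₂ p₁ * kroneckerBit p₃ p₁ + kroneckerBit p₂ p₁ * kroneckerBit p₃ p₂ +
      kroneckerBit p₃ p₁ * kroneckerBit p₃ p₂ = 1 := by
  have hp₁2 : p₁ ≠ 2 := by omega
  have hp₂2 : p₂ ≠ 2 := by omega
  have h12 : p₁ ≠ p₂ := fun h => by omega
  have h13 : p₁ ≠ p₃ := fun h => by omega
  have h23 : p₂ ≠ p₃ := fun h => by omega
  obtain ⟨a1, a2⟩ := kroneckerBit_of_jacobiSym hp₂ hp₁ hp₁2 h12.symm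
  obtain ⟨b1, b2⟩ := kroneckerBit_of_jacobiSym hp₃ hp₁ hp₁2 h13.symm
  obtain ⟨c1, c2⟩ := kroneckerBit_of_jacobiSym hp₃ hp₂ hp₂2 h23.symm
  have key : ∀ c : ZMod 2, (1 : ZMod 2) * 1 + 1 * c + 1 * c = 1 := by decide
  have key' : ∀ b : ZMod 2, (1 : ZMod 2) * b + 1 * 1 + b * 1 = 1 := by decide
  have key'' : ∀ a : ZMod 2, a * 1 + a * 1 + (1 : ZMod 2) * 1 = 1 := by decide
  rcases hj with ⟨ha, hb⟩ | ⟨ha, hc⟩ | ⟨hb, hc⟩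
  · rw [a2 ha, b2 hb]; exact key _
  · rw [a2 ha, c2 hc]; exact key' _
  · rw [b2 hb, c2 hc]; exact key'' _

/-- **TYZ's printed `Σ₂′(2p₁p₂p₃)` is EVEN on the sub-family `(p₃/p₂) = −1`, `(p₂/p₁) ≠ (p₃/p₁)`** of the type `(1, 5, 7)` (bits
`(0,1,1)` or `(1,0,1)`): Theorem 1.2 of [TianYuanZhang2017] and the tree's U⁺ door are SILENT there. Unconditional (RR instantiated).
[cite: TianYuanZhang2017, Thm. 1.2 (the second sum for n ≡ 6 (mod 8))] [cite: LiMa2008, Thm. 0.4] -/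
theorem not_odd_genusSum₂'_two_mul_157 (hp₁ : p₁.Prime) (hp₂ : p₂.Prime) (hp₃ : p₃.Prime) (h₁ : p₁ % 8 = 1)
    (h₂ : p₂ % 8 = 5) (h₃ : p₃ % 8 = 7) (hc : jacobiSym (p₃ : ℤ) p₂ = -1)
    (hab : jacobiSym (p₂ : ℤ) p₁ ≠ jacobiSym (p₃ : ℤ) p₁) :
    ¬ Odd (genusSum₂' (2 * (p₁ * p₂ * p₃)) fun d => genusClassNumber (GenusField d)) := by
  obtain ⟨ht, ht2, hinj⟩ := triple_157 hp₁ hp₂ hp₃ h₁ h₂ h₃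
  obtain ⟨hR, hB⟩ := cfg_157 hp₁ hp₂ hp₃ h₁ h₂ h₃
  have hp₁2 : p₁ ≠ 2 := by omega
  have hp₂2 : p₂ ≠ 2 := by omega
  have h12 : p₁ ≠ p₂ := fun h => by omega
  have h13 : p₁ ≠ p₃ := fun h => by omega
  have h23 : p₂ ≠ p₃ := fun h => by omega
  have hprod : 2 * ∏ i, (![p₁, p₂, p₃] : Fin 3 → ℕ) i = 2 * (p₁ * p₂ * p₃) := by rw [Fin.prod_univ_three]; rfl
  have h8 : (2 * ∏ i, (![p₁, p₂, p₃] : Fin 3 → ℕ) i) % 8 = 6 := by rw [hprod]; exact two_mul_157_mod_eight h₁ h₂ h₃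
  have h := natCast_genusSum₂'_two_mul_three_eq_cfg _ redeiReichardt_fourTwoCard_classGroup_holds ht ht2 hinj h8
  rw [hprod, hR, hB, sigma2'CfgEven_157] at h
  obtain ⟨a1, a2⟩ := kroneckerBit_of_jacobiSym hp₂ hp₁ hp₁2 h12.symm
  obtain ⟨b1, b2⟩ := kroneckerBit_of_jacobiSym hp₃ hp₁ hp₁2 h13.symm
  obtain ⟨-, c2⟩ := kroneckerBit_of_jacobiSym hp₃ hp₂ hp₂2 h23.symm
  rw [c2 hc] at h
  rw [← ZMod.natCast_eq_one_iff_odd, h]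
  rcases jacobiSym.eq_one_or_neg_one (int_gcd_prime_eq_one hp₂ hp₁ h12.symm) with ha | ha <;>
    rcases jacobiSym.eq_one_or_neg_one (int_gcd_prime_eq_one hp₃ hp₁ h13.symm) with hb | hb
  · exact absurd (ha.trans hb.symm) hab
  · rw [a1 ha, b2 hb]; decide
  · rw [a2 ha, b1 hb]; decide
  · exact absurd (ha.trans hb.symm) hab

/-- **Clause (a) on the explicit family, from {`tyz_cmPointGaloisData`, TYZ Thm. 1.1}**: for primes `p₁ ≡ 1`, `p₂ ≡ 5`, `p₃ ≡ 7
(mod 8)` with at least two of `(p₂/p₁), (p₃/p₁), (p₃/p₂)` equal to `−1`: `ord_{s=1} L(E_{2p₁p₂p₃}, s) = 1`. No GZK, no Selmer input,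
no genus-sum hypothesis — in particular on the half `(p₃/p₂) = −1`, `(p₂/p₁) ≠ (p₃/p₁)` where `Σ₂′(n)` is even
(`not_odd_genusSum₂'_two_mul_157`) and no printed theorem applies. CONDITIONAL; nothing asserted.
[cite: TianYuanZhang2017, §1 (definition of 𝓛(n), p0002 L46–L75), Thm. 1.1, §3 (Prop. 3.2, Thm. 3.5, Thm. 3.6, Lemma 3.18, J759)] -/
theorem analyticRank_eq_one_two_mul_157_family (hCM : tyz_cmPointGaloisData) (h11 : thm11_parity_of_scriptL) :
    ∀ p₁ p₂ p₃ : ℕ, p₁.Prime → p₂.Prime → p₃.Prime → p₁ % 8 = 1 → p₂ % 8 = 5 → p₃ % 8 = 7 →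
      ((jacobiSym (p₂ : ℤ) p₁ = -1 ∧ jacobiSym (p₃ : ℤ) p₁ = -1) ∨ (jacobiSym (p₂ : ℤ) p₁ = -1 ∧ jacobiSym (p₃ : ℤ) p₂ = -1) ∨
        (jacobiSym (p₃ : ℤ) p₁ = -1 ∧ jacobiSym (p₃ : ℤ) p₂ = -1)) →
      (congruentNumberCurve (2 * (p₁ * p₂ * p₃))).analyticRank = 1 :=
  fun _ _ _ hp₁ hp₂ hp₃ h₁ h₂ h₃ hj =>
    analyticRank_eq_one_two_mul_157_of_cmPointGaloisData hCM h11 hp₁ hp₂ hp₃ h₁ h₂ h₃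
      (bits_157_of_jacobiSym hp₁ hp₂ hp₃ h₁ h₂ h₃ hj)

/-- **Monsky's conjecture C-P2-2 at `k = 3` on the explicit family — `ord_{s=1} L = 1`, rank `1`, `Ш[2^∞] = 0`, `BSD(E_n, 2)`**
for `n = 2p₁p₂p₃`, primes `p₁ ≡ 1`, `p₂ ≡ 5`, `p₃ ≡ 7 (mod 8)`, at least two of `(p₂/p₁), (p₃/p₁), (p₃/p₂)` equal to `−1`, relative
to FOUR named facts: `tyz_cmPointGaloisData`, `thm11_parity_of_scriptL`, GZK, Monsky's even `2`-descent matrix theorem (`s(n) = 1`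
itself is kernel-decided). CONDITIONAL; nothing asserted; closes no class by itself (smallest members `2870`, `7910`).
[cite: TianYuanZhang2017, §1 (1.1), Thm. 1.1, Thm. 3.5, §3] [cite: HeathBrown1994SelmerCongruentII, Appendix (Monsky), typescript p. 41 L20–L36]
[cite: Miller2011LMS, Def. 1.1 (arXiv:1010.2431 p. 3)] -/
theorem rankOne_sha_bsdp_two_two_mul_157_family (hCM : tyz_cmPointGaloisData) (h11 : thm11_parity_of_scriptL)
    (hGZK : rank_eq_analyticRank_of_analyticRank_le_one) (hMe : monsky_card_selmerGroup_two_even) :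
    ∀ p₁ p₂ p₃ : ℕ, p₁.Prime → p₂.Prime → p₃.Prime → p₁ % 8 = 1 → p₂ % 8 = 5 → p₃ % 8 = 7 →
      ((jacobiSym (p₂ : ℤ) p₁ = -1 ∧ jacobiSym (p₃ : ℤ) p₁ = -1) ∨ (jacobiSym (p₂ : ℤ) p₁ = -1 ∧ jacobiSym (p₃ : ℤ) p₂ = -1) ∨
        (jacobiSym (p₃ : ℤ) p₁ = -1 ∧ jacobiSym (p₃ : ℤ) p₂ = -1)) →
      (congruentNumberCurve (2 * (p₁ * p₂ * p₃))).analyticRank = 1 ∧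
        (congruentNumberCurve (2 * (p₁ * p₂ * p₃))).mordellWeilRank = 1 ∧
        AddCommGroup.primaryComponent (congruentNumberCurve (2 * (p₁ * p₂ * p₃))).sha 2 = ⊥ ∧
        BSDp (congruentNumberCurve (2 * (p₁ * p₂ * p₃))) 2 :=
  fun _ _ _ hp₁ hp₂ hp₃ h₁ h₂ h₃ hj =>
    rankOne_sha_bsdp_two_two_mul_157 hCM h11 hGZK hMe hp₁ hp₂ hp₃ h₁ h₂ h₃
      (bits_157_of_jacobiSym hp₁ hp₂ hp₃ h₁ h₂ h₃ hj)

end ThetaDescent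

end Summit.BirchSwinnertonDyer.Rank1Residual.P2

end
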